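import Mathlib
import HarnessLib
import Summits.Ventures.LatticeQCDFlow.Exactness.CabibboMarinariORSweep
import Summits.Ventures.LatticeQCDFlow.Exactness.OpenBoundaryWilsonAction
import Summits.Ventures.LatticeQCDFlow.Exactness.TransformedKernel
import Summits.Ventures.LatticeQCDFlow.Exactness.GlobalAutomorphismSymmetry
import Summits.Ventures.LatticeQCDFlow.Scoring.SymmetricSamplerOddObservables

/-!
# Arm E1 is charge-conjugation symmetric: the Cabibbo–Marinari heat-bath sweep and every over-relaxation sweep commute with `U ↦ Ū` — `⟨Im tr P⟩ = 0` at EVERY sweep from a cold or hot start (periodic or open boundary)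

HONEST FRAMING: exact (Metropolis-corrected) sampling algorithms for lattice gauge theory;
figures of merit are autocorrelation/cost numbers at stated couplings and volumes; no
continuum-physics claim.

Venture `LatticeQCDFlow` (cell pub-lqcd), topic `Exactness`, FANOUT row 21 (`su3-base`, arm E1 = `'hb' + n_or × 'or'` and the
open-boundary heat-bath sweep).  NEW WORK of the cell: the charge-conjugation companion of `CMSweepCenterSymmetry` for the SAME E1
kernels (`cmLatOR`, `cmORSweep`, `latHit`, `latLink`, `latSweep`), over `GlobalAutomorphismSymmetry` (`configConj N = configAut (suConjAut N)`,
the Literature's entrywise conjugation `suConj`; `wilsonAction_configAut`, `obcAction_configAut`, `haarProbability_map_continuousMulEquiv`),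
row 7's `TransformedKernel` and row 16's `SymmetricSamplerOddObservables`.  Unlike the centre transformation, charge conjugation also
acts on the `SU(2)` element of every subgroup hit (`h ↦ h̄`, Haar invariant), and the COLD start `U ≡ 1` is invariant as well: the
chain-level consequences hold from the cold AND the hot start.  Nothing is cited as a fact; no number.

* §1 `quatDouble_map_conj`, `normSq_map_conj`, `quatUnit_map_conj`, `blockEmb_map_conj` / `blockEmbSU_suConj`, `stapleUp/Down_configAut`,
  `latStaple_configConj` (`R_l(Ū) = conj R_l(U)`), `cmQuat/cmUnit_configConj`, **`cmOR_configConj`** (`OR(Ū)_l = conj OR(U)_l`).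
* §2 **`conjKernel_cmLatOR_configConj`**, **`conjKernel_cmORSweep_configConj`** — every OR hit and sweep commutes with `C`.
* §3 `latFrameHom_suConj_mul`, `lintegral_haarSU2_comp_suConj` (substitute `h ↦ h̄` under `Haar(SU(2))`),
  **`conjKernel_latHit/latLink/latSweep_configConj`** for every `C`-invariant weight.
* §4 **`conjKernel_cmHeatBath_orSweep_configConj`** (Wilson weight), `integral_e1Chain_im_trace_eq_zero_of_equivariant`,
  **`integral_e1ColdStart_im_trace_lineHolonomy_eq_zero`**, **`integral_e1HotStart_im_trace_lineHolonomy_eq_zero`** — `Im tr` of every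
  straight / Polyakov line has expectation `0` at EVERY sweep of a cold- or hot-started `SU(N)` E1 run.
* §5 **`conjKernel_obcSweep_configConj`**, `integral_obcSweep_im_trace_lineHolonomy_eq_zero` — the same for the open-boundary heat-bath sweep.

NOT CLAIMED: stationarity; floating point; numbers.
-/


noncomputable section

open MeasureTheory ProbabilityTheory Function
open scoped ENNReal ComplexConjugate
open Literature.MathematicalPhysics.QuantumFieldTheory
open Literature.MathematicalPhysics.QuantumLattice (fundamentalRep suConj coe_suConj suConj_suConj)

namespace Summit.Ventures.LatticeQCDFlow.Exactness

/-! ## §1 Entrywise conjugation commutes with the engine's `SU(2)` data and with the staples -/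

section Algebra

variable {n : Type*} [Fintype n] [DecidableEq n] {m : Type*} [Fintype m] [DecidableEq m] (e : n ≃ Fin 2 ⊕ m)

/-- `quatDouble` commutes with entrywise conjugation. -/
theorem quatDouble_map_conj (W : Matrix (Fin 2) (Fin 2) ℂ) : quatDouble (W.map conj) = (quatDouble W).map conj := by
  ext i j; fin_cases i <;> fin_cases j <;> simp [quatDouble, quatOf, Matrix.map_apply, map_add, map_sub]

/-- The squared norm is conjugation invariant. -/
theorem normSq_map_conj (Q : Matrix (Fin 2) (Fin 2) ℂ) : IsQuat.normSq (Q.map conj) = IsQuat.normSq Q := by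
  simp [IsQuat.normSq, Matrix.map_apply, Complex.normSq_conj]

/-- `quatUnit` commutes with entrywise conjugation. -/
theorem quatUnit_map_conj (Q : Matrix (Fin 2) (Fin 2) ℂ) : quatUnit (Q.map conj) = (quatUnit Q).map conj := by
  unfold quatUnit; rw [normSq_map_conj]; split_ifs with h
  · rw [Matrix.map_one _ (map_zero _) (map_one _)]
  · ext i j; simp [Matrix.map_apply, Matrix.smul_apply]

omit [Fintype n] [DecidableEq n] [Fintype m] in
/-- The block embedding commutes with entrywise conjugation. -/
theorem blockEmb_map_conj (A : Matrix (Fin 2) (Fin 2) ℂ) : blockEmb e (A.map conj) = (blockEmb e A).map conj := by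
  unfold blockEmb
  rw [← Matrix.submatrix_map, Matrix.fromBlocks_map, Matrix.map_zero _ (map_zero _), Matrix.map_zero _ (map_zero _),
    Matrix.map_one _ (map_zero _) (map_one _)]

variable {N : ℕ} (e' : Fin N ≃ Fin 2 ⊕ m)

/-- The embedded subgroup element of the conjugate is the conjugate of the embedded element. -/
theorem blockEmbSU_suConj (A : Matrix.specialUnitaryGroup (Fin 2) ℂ) :
    blockEmbSU e' (suConj 2 A) = suConjAut N (blockEmbSU e' A) :=
  Subtype.ext (by rw [coe_blockEmbSU, suConjAut_apply, coe_suConj, coe_suConj, coe_blockEmbSU]; exact blockEmb_map_conj e' _)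

end Algebra

section Staples

variable {d L N : ℕ} {G : Type*} [Group G] [TopologicalSpace G] [MeasurableSpace G] [BorelSpace G] (φ : G ≃ₜ* G)

/-- Upper staples of `φ ∘ U` are `φ` of the upper staples. -/
theorem stapleUp_configAut (U : GaugeConfig d L G) (x : Site d L) (μ ν : Fin d) :
    Scoring.stapleUp (configAut φ U) x μ ν = φ (Scoring.stapleUp U x μ ν) := by
  simp only [Scoring.stapleUp, configAut_apply, map_mul, map_inv]

/-- Lower staples of `φ ∘ U` are `φ` of the lower staples. -/
theorem stapleDown_configAut (U : GaugeConfig d L G) (x : Site d L) (μ ν : Fin d) :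
    Scoring.stapleDown (configAut φ U) x μ ν = φ (Scoring.stapleDown U x μ ν) := by
  simp only [Scoring.stapleDown, configAut_apply, map_mul, map_inv]

end Staples

section StaplesConj

variable {d L N : ℕ}

/-- Upper staples of `Ū` are the conjugated upper staples. -/
theorem stapleUp_configConj (U : GaugeConfig d L (Matrix.specialUnitaryGroup (Fin N) ℂ)) (x : Site d L) (μ ν : Fin d) :
    Scoring.stapleUp (configConj N U) x μ ν = suConjAut N (Scoring.stapleUp U x μ ν) :=
  stapleUp_configAut (suConjAut N) U x μ ν

/-- Lower staples of `Ū` are the conjugated lower staples. -/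
theorem stapleDown_configConj (U : GaugeConfig d L (Matrix.specialUnitaryGroup (Fin N) ℂ)) (x : Site d L) (μ ν : Fin d) :
    Scoring.stapleDown (configConj N U) x μ ν = suConjAut N (Scoring.stapleDown U x μ ν) :=
  stapleDown_configAut (suConjAut N) U x μ ν

end StaplesConj

/-! ## §2 The over-relaxation hit and sweep commute with charge conjugation -/

section OverRelax

variable {d L N : ℕ} {m : Type*} [Fintype m] [DecidableEq m]

/-- **The staple sum of the conjugated field is the conjugated staple sum**: `R_l(Ū) = conj R_l(U)`. -/
theorem latStaple_configConj (U : GaugeConfig d L (Matrix.specialUnitaryGroup (Fin N) ℂ)) (l : Edge d L) :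
    latStaple (configConj N U) l = (latStaple U l).map conj := by
  unfold latStaple
  rw [Scoring.stapleSum_def, Scoring.stapleSum_def,
    show ∀ M : Matrix (Fin N) (Fin N) ℂ, M.map conj = (starRingEnd ℂ).mapMatrix M from fun M => rfl, map_sum]
  refine Finset.sum_congr rfl fun ν _ => ?_
  rw [map_add, stapleUp_configConj, stapleDown_configConj]
  rfl

omit [Fintype m] [DecidableEq m] in
/-- The subgroup data of the conjugated field: `Q(Ū R̄) = conj Q(U R)`. -/
theorem cmQuat_configConj (e : Fin N ≃ Fin 2 ⊕ m) (U : GaugeConfig d L (Matrix.specialUnitaryGroup (Fin N) ℂ)) (l : Edge d L) :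
    cmQuat e (latStaple (configConj N U) l) (configConj N U l) = (cmQuat e (latStaple U l) (U l)).map conj := by
  unfold cmQuat
  rw [← quatDouble_map_conj, latStaple_configConj]
  congr 1
  ext i j
  simp only [Matrix.toBlocks₁₁, Matrix.of_apply, Matrix.submatrix_apply, Matrix.map_apply, configConj, configAut_apply,
    suConjAut_apply, coe_suConj, ← Matrix.map_mul, Matrix.map_apply]

omit [Fintype m] [DecidableEq m] in
/-- The OR subgroup unit of the conjugated field is the conjugated unit. -/
theorem cmUnit_configConj (e : Fin N ≃ Fin 2 ⊕ m) (U : GaugeConfig d L (Matrix.specialUnitaryGroup (Fin N) ℂ)) (l : Edge d L) :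
    cmUnit e (latStaple (configConj N U) l) (configConj N U l) = suConj 2 (cmUnit e (latStaple U l) (U l)) :=
  Subtype.ext (by rw [coe_cmUnit, coe_suConj, coe_cmUnit, cmQuat_configConj, quatUnit_map_conj])

/-- **The engine's OR hit commutes with charge conjugation**: `OR(Ū)_l = conj (OR(U)_l)`. -/
theorem cmOR_configConj (e : Fin N ≃ Fin 2 ⊕ m) (U : GaugeConfig d L (Matrix.specialUnitaryGroup (Fin N) ℂ)) (l : Edge d L) :
    cmOR e (latStaple (configConj N U) l) (configConj N U l) = suConjAut N (cmOR e (latStaple U l) (U l)) := by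
  rw [cmOR, cmOR, cmUnit_configConj, map_mul (suConjAut N), ← blockEmbSU_suConj, map_mul (suConj 2), map_inv (suConj 2)]
  rfl

/-- The site update of the OR hit commutes with charge conjugation. -/
theorem siteUpdateMap_cmOR_configConj (e : Fin N ≃ Fin 2 ⊕ m) (l : Edge d L)
    (U : GaugeConfig d L (Matrix.specialUnitaryGroup (Fin N) ℂ)) :
    siteUpdateMap (X := fun _ : Edge d L => Matrix.specialUnitaryGroup (Fin N) ℂ) l (fun V g => cmOR e (latStaple V l) g)
        (configConj N U) =
      configConj N (siteUpdateMap (X := fun _ : Edge d L => Matrix.specialUnitaryGroup (Fin N) ℂ) l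
        (fun V g => cmOR e (latStaple V l) g) U) := by
  funext e'; simp only [siteUpdateMap]
  by_cases h : e' = l
  · subst h; rw [update_self, cmOR_configConj]; show _ = suConjAut N (update U e' _ e'); rw [update_self]
  · rw [update_of_ne h]; show suConjAut N (U e') = suConjAut N (update U l _ e'); rw [update_of_ne h]

variable [NeZero L]

/-- **The OR hit kernel intertwines charge conjugation**: `κ(Ū) = C_* κ(U)`. -/
theorem cmLatOR_configConj (l : Edge d L) (e : Fin N ≃ Fin 2 ⊕ m) (U : GaugeConfig d L (Matrix.specialUnitaryGroup (Fin N) ℂ)) :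
    cmLatOR (d := d) (L := L) l e (configConj N U) = (cmLatOR l e U).map (configConj N) := by
  simp only [cmLatOR, Kernel.deterministic_apply]
  rw [Measure.map_dirac' (MeasurableEquiv.measurable _), siteUpdateMap_cmOR_configConj]

omit [NeZero L] in
/-- Charge conjugation is an involution on configurations. -/
theorem configConj_symm_apply_eq (U : GaugeConfig d L (Matrix.specialUnitaryGroup (Fin N) ℂ)) :
    (configConj N).symm U = configConj (d := d) (L := L) N U := rfl

omit [NeZero L] in
/-- `C ∘ C = id` on configurations. -/
theorem configConj_comp_self : ((configConj (d := d) (L := L) N) ∘ (configConj N)) = id := by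
  funext V; rw [comp_apply, id_eq, ← configConj_symm_apply_eq (configConj N V)]; exact (configConj N).symm_apply_apply V

/-- **`conjKernel (OR hit at l, frame e) C = OR hit at l, frame e`.** -/
theorem conjKernel_cmLatOR_configConj (l : Edge d L) (e : Fin N ≃ Fin 2 ⊕ m) :
    conjKernel (cmLatOR (d := d) (L := L) l e) (configConj N) = cmLatOR l e := by
  refine ProbabilityTheory.Kernel.ext fun U => ?_
  rw [conjKernel_apply, configConj_symm_apply_eq, cmLatOR_configConj,
    Measure.map_map (configConj N).measurable (configConj N).measurable, configConj_comp_self, Measure.map_id]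

omit [NeZero L] in
/-- Reporting a cycle of kernels through `F` is the cycle of the reported kernels. -/
private theorem conjKernel_cycle_eq {Ω Ω' : Type*} [MeasurableSpace Ω] [MeasurableSpace Ω'] (F : Ω ≃ᵐ Ω') :
    ∀ ks : List (Kernel Ω Ω), conjKernel (cycle ks) F = cycle (ks.map fun κ => conjKernel κ F)
  | [] => by rw [cycle_nil, List.map_nil, cycle_nil, conjKernel_id]
  | κ :: ks => by rw [cycle_cons, List.map_cons, cycle_cons, conjKernel_comp, conjKernel_cycle_eq F ks]

/-- **EVERY OR SWEEP COMMUTES WITH CHARGE CONJUGATION.** -/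
theorem conjKernel_cmORSweep_configConj (sched : List (Edge d L × (Fin N ≃ Fin 2 ⊕ m))) :
    conjKernel (cmORSweep (d := d) (L := L) sched) (configConj N) = cmORSweep sched := by
  simp only [cmORSweep, conjKernel_cycle_eq, List.map_map]
  congr 1
  refine List.map_congr_left fun p _ => ?_
  simp only [comp_apply]
  exact conjKernel_cmLatOR_configConj p.1 p.2

end OverRelax

/-! ## §3 The Cabibbo–Marinari heat-bath hit, link update and sweep commute with charge conjugation -/

section HeatBath

variable {ι : Type*} [DecidableEq ι] {N : ℕ} {m : Type*} [Fintype m] [DecidableEq m]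

omit [DecidableEq ι] in
/-- Charge conjugation of a general link-indexed configuration (the heat-bath files index links by any `ι`). -/
theorem configAut_pi_apply (ω : Cfg ι (Fin N)) (i : ι) :
    (MeasurableEquiv.arrowCongr' (Equiv.refl ι) (suConjAut N).toHomeomorph.toMeasurableEquiv) ω i = suConj N (ω i) := rfl

/-- `φ_{l,e}(h̄) · Ū = conj (φ_{l,e}(h) · U)`. -/
theorem latFrameHom_suConj_mul (l : ι) (e : Fin N ≃ Fin 2 ⊕ m) (h : Matrix.specialUnitaryGroup (Fin 2) ℂ) (ω : Cfg ι (Fin N)) :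
    latFrameHom l e (suConj 2 h) * (MeasurableEquiv.arrowCongr' (Equiv.refl ι) (suConjAut N).toHomeomorph.toMeasurableEquiv) ω =
      (MeasurableEquiv.arrowCongr' (Equiv.refl ι) (suConjAut N).toHomeomorph.toMeasurableEquiv) (latFrameHom l e h * ω) := by
  funext i; rw [Pi.mul_apply, configAut_pi_apply, configAut_pi_apply, Pi.mul_apply, map_mul]
  simp only [latFrameHom, MonoidHom.coe_comp, comp_apply, linkHom_apply]
  by_cases hi : i = l
  · subst hi; rw [Pi.mulSingle_eq_same, Pi.mulSingle_eq_same, blockEmbSU_suConj, suConjAut_apply]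
  · rw [Pi.mulSingle_eq_of_ne hi, Pi.mulSingle_eq_of_ne hi, map_one]

/-- **Substituting `h ↦ h̄` under `Haar(SU(2))`** (entrywise conjugation preserves the Haar probability measure). -/
theorem lintegral_haarSU2_comp_suConj (F : Matrix.specialUnitaryGroup (Fin 2) ℂ → ℝ≥0∞) :
    ∫⁻ h, F (suConj 2 h) ∂haarSU2 = ∫⁻ h, F h ∂haarSU2 := by
  have hmap : haarSU2.map ((suConjAut 2).toHomeomorph.toMeasurableEquiv) = haarSU2 :=
    haarProbability_map_continuousMulEquiv (suConjAut 2)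
  conv_rhs => rw [← hmap]
  rw [lintegral_map_equiv]
  rfl

/-- **The Cabibbo–Marinari heat-bath hit commutes with charge conjugation** for every `C`-invariant weight. -/
theorem conjKernel_latHit_configConj {p : Cfg ι (Fin N) → ℝ≥0∞} (hp : Measurable p)
    (hpc : ∀ ω : Cfg ι (Fin N), p ((MeasurableEquiv.arrowCongr' (Equiv.refl ι) (suConjAut N).toHomeomorph.toMeasurableEquiv) ω) = p ω)
    (l : ι) (e : Fin N ≃ Fin 2 ⊕ m) :
    conjKernel (latHit p l e) (MeasurableEquiv.arrowCongr' (Equiv.refl ι) (suConjAut N).toHomeomorph.toMeasurableEquiv) = latHit p l e := by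
  set C := MeasurableEquiv.arrowCongr' (Equiv.refl ι) (suConjAut N).toHomeomorph.toMeasurableEquiv with hC
  have hsymm : ∀ ω : Cfg ι (Fin N), C.symm ω = C ω := fun ω => by funext i; rfl
  have hCC : ∀ ω : Cfg ι (Fin N), C (C ω) = ω := fun ω => by rw [← hsymm (C ω)]; exact C.symm_apply_apply ω
  have hZ : ∀ ω, subgroupNorm haarSU2 (latFrameHom l e) p (C ω) = subgroupNorm haarSU2 (latFrameHom l e) p ω := by
    intro ω; unfold subgroupNorm; rw [← lintegral_haarSU2_comp_suConj]
    exact lintegral_congr fun h => by rw [latFrameHom_suConj_mul, hpc]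
  have hind : ∀ (B : Set (Cfg ι (Fin N))) (y : Cfg ι (Fin N)), (⇑C ⁻¹' B).indicator (1 : Cfg ι (Fin N) → ℝ≥0∞) (C y) = B.indicator 1 y :=
    fun B y => by
    by_cases hy : y ∈ B
    · rw [Set.indicator_of_mem hy, Set.indicator_of_mem (show C y ∈ ⇑C ⁻¹' B by rw [Set.mem_preimage, hCC]; exact hy)]
      rfl
    · rw [Set.indicator_of_notMem hy, Set.indicator_of_notMem (show C y ∉ ⇑C ⁻¹' B by rw [Set.mem_preimage, hCC]; exact hy)]
  refine ProbabilityTheory.Kernel.ext fun ω => Measure.ext fun B hB => ?_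
  rw [conjKernel_apply' _ _ _ hB, hsymm]
  simp only [latHit]
  rw [subgroupHaarHeatBath_apply _ _ (measurable_latFrameHom l e) hp _ (C.measurable hB),
    subgroupHaarHeatBath_apply _ _ (measurable_latFrameHom l e) hp _ hB, ← lintegral_haarSU2_comp_suConj]
  refine lintegral_congr fun h => ?_
  rw [hZ, latFrameHom_suConj_mul, hpc, hind]

/-- The link update commutes with charge conjugation. -/
theorem conjKernel_latLink_configConj {p : Cfg ι (Fin N) → ℝ≥0∞} (hp : Measurable p)
    (hpc : ∀ ω : Cfg ι (Fin N), p ((MeasurableEquiv.arrowCongr' (Equiv.refl ι) (suConjAut N).toHomeomorph.toMeasurableEquiv) ω) = p ω)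
    (frames : List (Fin N ≃ Fin 2 ⊕ m)) (l : ι) :
    conjKernel (latLink p frames l) (MeasurableEquiv.arrowCongr' (Equiv.refl ι) (suConjAut N).toHomeomorph.toMeasurableEquiv) =
      latLink p frames l := by
  simp only [latLink, conjKernel_cycle_eq, List.map_map]
  congr 1
  refine List.map_congr_left fun e _ => ?_
  simp only [comp_apply]
  exact conjKernel_latHit_configConj hp hpc l e

/-- **THE HEAT-BATH SWEEP COMMUTES WITH CHARGE CONJUGATION** for every `C`-invariant weight. -/
theorem conjKernel_latSweep_configConj {p : Cfg ι (Fin N) → ℝ≥0∞} (hp : Measurable p)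
    (hpc : ∀ ω : Cfg ι (Fin N), p ((MeasurableEquiv.arrowCongr' (Equiv.refl ι) (suConjAut N).toHomeomorph.toMeasurableEquiv) ω) = p ω)
    (frames : List (Fin N ≃ Fin 2 ⊕ m)) (links : List ι) :
    conjKernel (latSweep p frames links) (MeasurableEquiv.arrowCongr' (Equiv.refl ι) (suConjAut N).toHomeomorph.toMeasurableEquiv) =
      latSweep p frames links := by
  simp only [latSweep, conjKernel_cycle_eq, List.map_map]
  congr 1
  refine List.map_congr_left fun l _ => ?_
  simp only [comp_apply]
  exact conjKernel_latLink_configConj hp hpc frames l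

end HeatBath

/-! ## §4 Row 21's E1 composite is charge-conjugation symmetric; `E_n[Im tr P] = 0` from the cold and the hot start -/

section Composite

variable {d L N : ℕ} [NeZero L] {m : Type*} [Fintype m] [DecidableEq m]

/-- The Wilson weight `e^{−βS_W}` is `C`-even (`wilsonAction_configAut` with `Re tr Ā = Re tr A`). -/
theorem gibbsDensity_wilson_configConj (β : ℝ) (ω : GaugeConfig d L (Matrix.specialUnitaryGroup (Fin N) ℂ)) :
    gibbsDensity (fun U : GaugeConfig d L (Matrix.specialUnitaryGroup (Fin N) ℂ) => β * wilsonAction (suRep N) U) (configConj N ω) =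
      gibbsDensity (fun U : GaugeConfig d L (Matrix.specialUnitaryGroup (Fin N) ℂ) => β * wilsonAction (suRep N) U) ω := by
  simp only [gibbsDensity, configConj, wilsonAction_configAut (ρ := suRep N) (re_trace_fundamentalRep_suConjAut N)]

/-- **ROW 21's E1 COMPOSITE COMMUTES WITH CHARGE CONJUGATION** (Wilson weight, every `β`, frames, link order, OR schedule). -/
theorem conjKernel_cmHeatBath_orSweep_configConj (β : ℝ) (frames : List (Fin N ≃ Fin 2 ⊕ m)) (links : List (Edge d L))
    (sched : List (Edge d L × (Fin N ≃ Fin 2 ⊕ m))) :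
    conjKernel (cmORSweep (d := d) (L := L) sched ∘ₖ
        latSweep (gibbsDensity fun U : GaugeConfig d L (Matrix.specialUnitaryGroup (Fin N) ℂ) => β * wilsonAction (suRep N) U)
          frames links) (configConj N) =
      cmORSweep sched ∘ₖ
        latSweep (gibbsDensity fun U : GaugeConfig d L (Matrix.specialUnitaryGroup (Fin N) ℂ) => β * wilsonAction (suRep N) U)
          frames links := by
  rw [conjKernel_comp, conjKernel_cmORSweep_configConj]
  congr 1
  exact conjKernel_latSweep_configConj
    (measurable_gibbsDensity (continuous_smul_wilsonAction (suRep N) continuous_suRep β)) (gibbsDensity_wilson_configConj β) frames links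

/-- **`E_n[Im tr h] = 0` AT EVERY SWEEP** for every conjugation-equivariant `SU(N)`-valued loop functional `h` (links, plaquettes, straight /
Polyakov lines), from any `C`-invariant start. -/
theorem integral_e1Chain_im_trace_eq_zero_of_equivariant (β : ℝ) (frames : List (Fin N ≃ Fin 2 ⊕ m)) (links : List (Edge d L))
    (sched : List (Edge d L × (Fin N ≃ Fin 2 ⊕ m))) {μ₀ : Measure (GaugeConfig d L (Matrix.specialUnitaryGroup (Fin N) ℂ))}
    (hμ₀ : μ₀.map (configConj N) = μ₀) (nsw : ℕ)
    {h : GaugeConfig d L (Matrix.specialUnitaryGroup (Fin N) ℂ) → Matrix.specialUnitaryGroup (Fin N) ℂ}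
    (hh : ∀ U, h (configConj N U) = suConjAut N (h U)) :
    ∫ U, (fundamentalRep (Fin N) (h U)).trace.im ∂(μ₀.bind (nHit (cmORSweep (d := d) (L := L) sched ∘ₖ
        latSweep (gibbsDensity fun U : GaugeConfig d L (Matrix.specialUnitaryGroup (Fin N) ℂ) => β * wilsonAction (suRep N) U)
          frames links) nsw)) = 0 := by
  have hlaw := Scoring.map_bind_nHit_eq_self (conjKernel_cmHeatBath_orSweep_configConj (d := d) (L := L) (N := N) β frames links sched)
    hμ₀ nsw
  have key := (MeasurePreserving.mk (configConj N).measurable hlaw).integral_comp'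
    (fun U : GaugeConfig d L (Matrix.specialUnitaryGroup (Fin N) ℂ) => (fundamentalRep (Fin N) (h U)).trace.im)
  simp only [im_trace_odd_of_configConj_equivariant N hh, integral_neg] at key
  linarith

/-- **COLD START (`U ≡ 1`, `C`-invariant): `E_n[Im tr P(y)] = 0` at every sweep** for every straight / Polyakov line. -/
theorem integral_e1ColdStart_im_trace_lineHolonomy_eq_zero (β : ℝ) (frames : List (Fin N ≃ Fin 2 ⊕ m)) (links : List (Edge d L))
    (sched : List (Edge d L × (Fin N ≃ Fin 2 ⊕ m))) (nsw : ℕ) (k : Fin d) (q : ℕ) (y : Site d L) :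
    ∫ U, (fundamentalRep (Fin N) (lineHolonomy U k q y)).trace.im ∂((Measure.dirac 1).bind (nHit (cmORSweep (d := d) (L := L) sched ∘ₖ
        latSweep (gibbsDensity fun U : GaugeConfig d L (Matrix.specialUnitaryGroup (Fin N) ℂ) => β * wilsonAction (suRep N) U)
          frames links) nsw)) = 0 := by
  have h1 : configConj N (1 : GaugeConfig d L (Matrix.specialUnitaryGroup (Fin N) ℂ)) = 1 := funext fun _ => map_one (suConjAut N)
  have hμ₀ : (Measure.dirac (1 : GaugeConfig d L (Matrix.specialUnitaryGroup (Fin N) ℂ))).map (configConj N) = Measure.dirac 1 := by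
    rw [Measure.map_dirac' (configConj N).measurable, h1]
  exact integral_e1Chain_im_trace_eq_zero_of_equivariant β frames links sched hμ₀ nsw fun U => lineHolonomy_configConj N U k q y

/-- **HOT START (`∏ dHaar`, `C`-invariant): `E_n[Im tr P(y)] = 0` at every sweep** for every straight / Polyakov line. -/
theorem integral_e1HotStart_im_trace_lineHolonomy_eq_zero (β : ℝ) (frames : List (Fin N ≃ Fin 2 ⊕ m)) (links : List (Edge d L))
    (sched : List (Edge d L × (Fin N ≃ Fin 2 ⊕ m))) (nsw : ℕ) (k : Fin d) (q : ℕ) (y : Site d L) :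
    ∫ U, (fundamentalRep (Fin N) (lineHolonomy U k q y)).trace.im
        ∂((Measure.pi fun _ : Edge d L => haarProbability (Matrix.specialUnitaryGroup (Fin N) ℂ)).bind
          (nHit (cmORSweep (d := d) (L := L) sched ∘ₖ
            latSweep (gibbsDensity fun U : GaugeConfig d L (Matrix.specialUnitaryGroup (Fin N) ℂ) => β * wilsonAction (suRep N) U)
              frames links) nsw)) = 0 :=
  integral_e1Chain_im_trace_eq_zero_of_equivariant β frames links sched
    (measurePreserving_configAut_piHaar (d := d) (L := L) (suConjAut N)).map_eq nsw fun U => lineHolonomy_configConj N U k q y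

end Composite

/-! ## §5 The open-boundary heat-bath sweep is charge-conjugation symmetric too -/

section OpenBoundary

variable {d L N M : ℕ} [NeZero L] {m : Type*} [Fintype m] [DecidableEq m]
  (ρ : Matrix.specialUnitaryGroup (Fin N) ℂ →* Matrix (Fin M) (Fin M) ℂ)

/-- The open-boundary weight `e^{−β S_OBC}` is `C`-even whenever `Re tr ρ` is (`obcAction_configAut`). -/
theorem gibbsDensity_obc_configConj (hρ : ∀ g, (ρ (suConjAut N g)).trace.re = (ρ g).trace.re) (τ : Fin d) (β : ℝ)
    (ω : GaugeConfig d L (Matrix.specialUnitaryGroup (Fin N) ℂ)) :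
    gibbsDensity (fun U : GaugeConfig d L (Matrix.specialUnitaryGroup (Fin N) ℂ) => β * obcAction ρ τ U) (configConj N ω) =
      gibbsDensity (fun U : GaugeConfig d L (Matrix.specialUnitaryGroup (Fin N) ℂ) => β * obcAction ρ τ U) ω := by
  simp only [gibbsDensity, configConj, obcAction_configAut (ρ := ρ) hρ]

/-- **THE OPEN-BOUNDARY HEAT-BATH SWEEP (`OpenBoundaryCMSweep`'s kernel) COMMUTES WITH CHARGE CONJUGATION** in the fundamental
representation (every `β`, `τ`, frame list, link order). -/
theorem conjKernel_obcSweep_configConj (τ : Fin d) (β : ℝ) (frames : List (Fin N ≃ Fin 2 ⊕ m)) (links : List (Edge d L)) :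
    conjKernel (latSweep (gibbsDensity fun U : GaugeConfig d L (Matrix.specialUnitaryGroup (Fin N) ℂ) => β * obcAction (suRep N) τ U)
        frames links) (configConj N) =
      latSweep (gibbsDensity fun U : GaugeConfig d L (Matrix.specialUnitaryGroup (Fin N) ℂ) => β * obcAction (suRep N) τ U)
        frames links :=
  conjKernel_latSweep_configConj (measurable_gibbsDensity (continuous_const.mul (continuous_obcAction (suRep N) continuous_suRep τ)))
    (gibbsDensity_obc_configConj (suRep N) (re_trace_fundamentalRep_suConjAut N) τ β) frames links

/-- **OPEN BOUNDARY, COLD OR HOT START: `E_n[Im tr P(y)] = 0` AT EVERY SWEEP** of the open-boundary heat-bath chain, for every straight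
line of the lattice (every open direction `τ`, `β`, volume, base site). -/
theorem integral_obcSweep_im_trace_lineHolonomy_eq_zero (τ : Fin d) (β : ℝ) (frames : List (Fin N ≃ Fin 2 ⊕ m))
    (links : List (Edge d L)) {μ₀ : Measure (GaugeConfig d L (Matrix.specialUnitaryGroup (Fin N) ℂ))}
    (hμ₀ : μ₀.map (configConj N) = μ₀) (nsw : ℕ) (k : Fin d) (q : ℕ) (y : Site d L) :
    ∫ U, (fundamentalRep (Fin N) (lineHolonomy U k q y)).trace.im ∂(μ₀.bind (nHit (latSweep
        (gibbsDensity fun U : GaugeConfig d L (Matrix.specialUnitaryGroup (Fin N) ℂ) => β * obcAction (suRep N) τ U) frames links) nsw)) =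
      0 := by
  have hlaw := Scoring.map_bind_nHit_eq_self (conjKernel_obcSweep_configConj (d := d) (L := L) (N := N) τ β frames links) hμ₀ nsw
  have key := (MeasurePreserving.mk (configConj N).measurable hlaw).integral_comp'
    (fun U : GaugeConfig d L (Matrix.specialUnitaryGroup (Fin N) ℂ) => (fundamentalRep (Fin N) (lineHolonomy U k q y)).trace.im)
  simp only [im_trace_odd_of_configConj_equivariant N
    (h := fun U : GaugeConfig d L (Matrix.specialUnitaryGroup (Fin N) ℂ) => lineHolonomy U k q y)
    (fun U => lineHolonomy_configConj N U k q y), integral_neg] at key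
  linarith

end OpenBoundary

end Summit.Ventures.LatticeQCDFlow.Exactness
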